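import Mathlib
import HarnessLib

/-!
# Zhang (2022), §4 p. 9: the function `𝒜 = L(s,ψ)L(s,ψχ)/F`, "`F⁻¹ ≪ 𝓛^{79}`", the derivation of
# (4.10), Lemma 4.5 (Case 1) and Lemma 4.8 — the algebra with explicit error terms, kernel-checked

Topic `Literature/NumberTheory/LFunctions/Zhang2022` (Landau–Siegel autopsy tree; verdict-neutral).
Y. Zhang, *Discrete mean estimates and the Landau–Siegel zero*, arXiv:2211.02515v1 (2022) — **an
unrefereed manuscript, a claimed result under adjudication** (cell pub-zhang: audit + repair census
of arXiv:2211.02515; no claim about Landau–Siegel) — §4 p. 9: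

> In order to prove Proposition 2.2, it is appropriate to deal with the function
> `𝒜(s,ψ) = L(s,ψ)L(s,ψχ)/F(s,ψ)`. By Lemma 4.2, `𝒜(s,ψ)` is analytic and it has the same zeros as
> `L(s,ψ)L(s,ψχ)` in `Ω₁`. Further, for `s ∈ Ω₁`, we have `F(s,ψ)⁻¹ ≪ 𝓛^{79}` by Lemma 4.1 and 4.2.
> This together with Lemma 4.4 implies that `𝒜(s,ψ) = 1 + ℬ(s,ψ) + O(𝓛^{−100})` (4.10) for
> `s ∈ Ω₃`, where `ℬ(s,ψ) = Z̃(s,ψ)F(1−s,ψ̄)/F(s,ψ)`. […]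
> [Lemma 4.5] Case 1. `1/2 + 𝓛⁻¹ ≤ σ < 1`. By Lemma 4.2 and trivial estimation, `F(1−s,ψ̄)/F(s,ψ) ≪ D^c`.
> Hence, by (4.5), `ℬ(s,ψ) ≪ P^{1/2−σ}`. The result now follows by (4.10). […]
> Lemma 4.8. Assume that `ρ` is a zero of `L(s,ψ)L(s,ψχ)` in `Ω`. Then we have
> `Z̃(ρ,ψ)⁻¹ = −G(ρ,ψ)F(1−ρ,ψ̄) + O(𝓛^{−100})`.
> Proof. It follows from Lemma 4.4 that `F(ρ,ψ) + Z̃(ρ,ψ)F(1−ρ,ψ̄) ≪ 𝓛^{−179}`. The result follows by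
> multiplying both sides by `Z̃(ρ,ψ)⁻¹G(ρ,ψ)` and applying Lemma 4.1. □

The INPUTS are Lemma 4.1 (`|F| + |G| ≪ 𝓛^{79}`), Lemma 4.2 (`FG = 1 + O(𝓛^{−227})`), Lemma 4.4
(`LL = F + Z̃F̄ + O(𝓛^{−179})`, `F̄ := F(1−·,ψ̄)`) and (4.5) (`|Z̃|`). This file PROVES the displayed
inferences from them as statements about complex numbers / functions with every error explicit
(namespace `Lemma48`; the exponent bookkeeping `100 = min(179 − 79, 227)` is the cell's design rows
I-4.10a / I-L4.8a):

* `Lemma48.ne_zero_of_norm_mul_sub_one_lt` — **"By Lemma 4.2, `𝒜` is analytic [i.e. `F ≠ 0`]"**: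
  `|FG − 1| < 1 ⇒ F ≠ 0`; `Lemma48.div_eq_zero_iff` — **"it has the same zeros as `L(s,ψ)L(s,ψχ)`"**;
  `Lemma48.analyticAt_calA` — analyticity of `LL/F` where `F ≠ 0`;
* `Lemma48.norm_inv_le` — **"`F⁻¹ ≪ 𝓛^{79}` by Lemma 4.1 and 4.2"**: `|FG − 1| ≤ ε < 1`, `|G| ≤ M`
  `⇒ |F⁻¹| ≤ M/(1 − ε)`;
* `Lemma48.calA_eq`, `Lemma48.norm_calA_sub_le` — **(4.10) EXACT with its error**: if
  `LL = F + Z̃F̄ + R` then `𝒜 = LL/F = 1 + ℬ + R/F`, `ℬ = Z̃F̄/F`, and `|𝒜 − 1 − ℬ| ≤ |R|·M/(1−ε)`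
  (`𝓛^{−179}·𝓛^{79}·(1+o(1)) = O(𝓛^{−100})`);
* `Lemma48.norm_calB_le`, `Lemma48.calA_ne_zero` — **Lemma 4.5, Case 1**: `|ℬ| ≤ |Z̃|·|F̄(1−s)|·M/(1−ε)`
  ("trivial estimation" and "`F⁻¹ ≪`"), and `|𝒜 − 1 − ℬ| ≤ E`, `|ℬ| + E < 1 ⇒ 𝒜 ≠ 0`; the bookkeeping
  "by (4.5), `ℬ ≪ P^{1/2−σ}`": `Lemma48.rpow_half_sub_le_exp_neg` (`P = e^{𝓛⁹}`, `σ − 1/2 ≥ 𝓛⁻¹ ⇒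
  P^{1/2−σ} ≤ e^{−𝓛⁸}`) and `Lemma48.norm_calB_le_case1` (one factor `P^{1/2−σ}` absorbs `D^c`);
* `Lemma48.norm_add_le_of_eq_zero`, `Lemma48.lemma48` — **Lemma 4.8 EXACT with its error**: at a zero
  `ρ` of `LL`, `|F + Z̃F̄| ≤ |R| ≤ ε₁`; and from `|F + Z̃F̄| ≤ ε₁`, `|FG − 1| ≤ ε₂`, `Z̃ ≠ 0`:
  `|Z̃⁻¹ + G·F̄| ≤ |Z̃⁻¹|(|G|ε₁ + ε₂)` ("multiplying both sides by `Z̃⁻¹G` and applying Lemma 4.1";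
  with (4.5) at `β = 1/2`, `|Z̃(ρ)⁻¹| = 1 + o(1)`, this is `𝓛^{79}𝓛^{−179} + 𝓛^{−227} = O(𝓛^{−100})`).

What is NOT asserted: Lemmas 4.1, 4.2, 4.4 and (4.5) themselves, hence neither (4.10) nor Lemma 4.8
for `ψ ∈ Ψ₁` as such. Nothing about Theorems 1–2 of the source is stated or implied; nothing here
bears on the cell's verdict on (8.24).

## References

* Y. Zhang, arXiv:2211.02515v1 (2022), §4 p. 9: the paragraph introducing `𝒜` and (4.10); Lemma 4.5
  (proof, Case 1); Lemma 4.8 and its proof. [cite: Zhang2022LandauSiegel, §4 (4.10), Lemma 4.8]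
-/

noncomputable section

open Complex

namespace Literature.NumberTheory.LFunctions.Zhang2022

namespace Lemma48

/-! ### `𝒜 = LL/F`: `F ≠ 0` by Lemma 4.2, same zeros as `LL`, analytic -/

/-- **"By Lemma 4.2, `𝒜(s,ψ)` is analytic"** — the point being `F(s,ψ) ≠ 0` on `Ω₁`: if `|FG − 1| < 1`
then `F ≠ 0`. [cite: Zhang2022LandauSiegel, §4 (4.10)] -/
theorem ne_zero_of_norm_mul_sub_one_lt {F G : ℂ} (h : ‖F * G - 1‖ < 1) : F ≠ 0 := by
  rintro rfl
  simp at h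

/-- **"it has the same zeros as `L(s,ψ)L(s,ψχ)` in `Ω₁`"**: for `F ≠ 0`, `LL/F = 0 ↔ LL = 0`.
[cite: Zhang2022LandauSiegel, §4 (4.10)] -/
theorem div_eq_zero_iff' {LL F : ℂ} (hF : F ≠ 0) : LL / F = 0 ↔ LL = 0 := by
  rw [div_eq_zero_iff, or_iff_left hF]

/-- **"`𝒜(s,ψ)` is analytic"**: `LL/F` is analytic wherever `LL`, `F` are and `F ≠ 0`.
[cite: Zhang2022LandauSiegel, §4 (4.10)] -/
theorem analyticAt_calA {LL F : ℂ → ℂ} {s : ℂ} (hLL : AnalyticAt ℂ LL s) (hF : AnalyticAt ℂ F s)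
    (h0 : F s ≠ 0) : AnalyticAt ℂ (fun z => LL z / F z) s :=
  hLL.div hF h0

/-! ### "`F⁻¹ ≪ 𝓛^{79}` by Lemma 4.1 and 4.2" -/

/-- **"for `s ∈ Ω₁`, we have `F(s,ψ)⁻¹ ≪ 𝓛^{79}` by Lemma 4.1 and 4.2"**, EXACT with its constant:
`|FG − 1| ≤ ε < 1` (Lemma 4.2) and `|G| ≤ M` (Lemma 4.1) give `|F⁻¹| ≤ M/(1 − ε)` (`F⁻¹ = G/(FG)`).
[cite: Zhang2022LandauSiegel, §4 (4.10)] -/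
theorem norm_inv_le {F G : ℂ} {ε M : ℝ} (hε : ε < 1) (h42 : ‖F * G - 1‖ ≤ ε) (h41 : ‖G‖ ≤ M) :
    ‖F⁻¹‖ ≤ M / (1 - ε) := by
  have hF : F ≠ 0 := ne_zero_of_norm_mul_sub_one_lt (h42.trans_lt hε)
  have hFG : 1 - ε ≤ ‖F * G‖ := by
    have := norm_sub_norm_le (1 : ℂ) (1 - F * G)
    rw [norm_one, sub_sub_cancel, norm_sub_rev] at this
    linarith
  have hpos : 0 < 1 - ε := by linarith
  have hFG0 : F * G ≠ 0 := by
    intro h0; rw [h0, norm_zero] at hFG; linarith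
  have hG : G ≠ 0 := fun h => hFG0 (by rw [h, mul_zero])
  have hinv : F⁻¹ = G / (F * G) := by
    field_simp
  rw [hinv, norm_div]
  calc ‖G‖ / ‖F * G‖ ≤ M / ‖F * G‖ := div_le_div_of_nonneg_right h41 (norm_nonneg _)
    _ ≤ M / (1 - ε) := by
        apply div_le_div_of_nonneg_left ((norm_nonneg G).trans h41) hpos hFG

/-! ### (4.10) -/

/-- **(4.10), EXACT form**: if `LL = F + Z̃F̄ + R` (Lemma 4.4 with its remainder `R`) and `F ≠ 0`, then
`𝒜 := LL/F = 1 + ℬ + R/F` with `ℬ := Z̃F̄/F`. [cite: Zhang2022LandauSiegel, §4 (4.10)] -/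
theorem calA_eq {LL F Z Fb R : ℂ} (hF : F ≠ 0) (h44 : LL = F + Z * Fb + R) :
    LL / F = 1 + Z * Fb / F + R / F := by
  rw [h44]
  field_simp

/-- **(4.10) with its error term**: under Lemma 4.4 (`|LL − (F + Z̃F̄)| ≤ ε₄₄`), Lemma 4.2
(`|FG − 1| ≤ ε < 1`) and Lemma 4.1 (`|G| ≤ M`): `|𝒜 − 1 − ℬ| ≤ ε₄₄·M/(1 − ε)` — the manuscript's
`O(𝓛^{−179}·𝓛^{79}) = O(𝓛^{−100})`. [cite: Zhang2022LandauSiegel, §4 (4.10)] -/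
theorem norm_calA_sub_le {LL F G Z Fb : ℂ} {ε₄₄ ε M : ℝ} (hε : ε < 1)
    (h44 : ‖LL - (F + Z * Fb)‖ ≤ ε₄₄) (h42 : ‖F * G - 1‖ ≤ ε) (h41 : ‖G‖ ≤ M) :
    ‖LL / F - 1 - Z * Fb / F‖ ≤ ε₄₄ * (M / (1 - ε)) := by
  have hF : F ≠ 0 := ne_zero_of_norm_mul_sub_one_lt (h42.trans_lt hε)
  have hsplit : LL / F - 1 - Z * Fb / F = (LL - (F + Z * Fb)) * F⁻¹ := by
    field_simp
    ring
  rw [hsplit, norm_mul]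
  exact mul_le_mul h44 (norm_inv_le hε h42 h41) (norm_nonneg _) ((norm_nonneg _).trans h44)

/-! ### Lemma 4.5, Case 1 -/

/-- **"By Lemma 4.2 and trivial estimation, `F(1−s,ψ̄)/F(s,ψ) ≪ D^c`. Hence, by (4.5),
`ℬ(s,ψ) ≪ P^{1/2−σ}`"**, structural: `|ℬ| = |Z̃|·|F̄(1−s)|·|F⁻¹| ≤ z·B·M/(1−ε)` from `|Z̃| ≤ z`
((4.5)), the trivial bound `|F̄(1−s)| ≤ B` and "`F⁻¹ ≪`". [cite: Zhang2022LandauSiegel, §4 Lemma 4.5 (proof)] -/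
theorem norm_calB_le {F G Z Fb : ℂ} {ε M z B : ℝ} (hε : ε < 1) (h42 : ‖F * G - 1‖ ≤ ε)
    (h41 : ‖G‖ ≤ M) (hZ : ‖Z‖ ≤ z) (hFb : ‖Fb‖ ≤ B) :
    ‖Z * Fb / F‖ ≤ z * B * (M / (1 - ε)) := by
  rw [div_eq_mul_inv, norm_mul, norm_mul]
  have h1 := norm_inv_le hε h42 h41
  have hz : 0 ≤ z := (norm_nonneg _).trans hZ
  have hB : 0 ≤ B := (norm_nonneg _).trans hFb
  gcongr

/-- **"The result now follows by (4.10)"**: `|𝒜 − 1 − ℬ| ≤ E` and `|ℬ| + E < 1` give `𝒜 ≠ 0`.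
[cite: Zhang2022LandauSiegel, §4 Lemma 4.5 (proof)] -/
theorem calA_ne_zero {A B : ℂ} {E : ℝ} (h410 : ‖A - 1 - B‖ ≤ E) (hsmall : ‖B‖ + E < 1) : A ≠ 0 := by
  intro hA
  rw [hA, zero_sub, ← norm_neg, neg_sub, sub_neg_eq_add] at h410
  have : 1 - ‖B‖ ≤ ‖B + 1‖ := by
    have := norm_sub_norm_le (1 : ℂ) (-B)
    rw [norm_one, norm_neg, sub_neg_eq_add, add_comm] at this
    exact this
  linarith

/-! ### Lemma 4.8 -/

/-- **"It follows from Lemma 4.4 that `F(ρ,ψ) + Z̃(ρ,ψ)F(1−ρ,ψ̄) ≪ 𝓛^{−179}`"**: at a zero `ρ` of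
`LL`, `|LL − (F + Z̃F̄)| ≤ ε₄₄` gives `|F + Z̃F̄| ≤ ε₄₄`. [cite: Zhang2022LandauSiegel, §4 Lemma 4.8 (proof)] -/
theorem norm_add_le_of_eq_zero {LL F Z Fb : ℂ} {ε₄₄ : ℝ} (hρ : LL = 0)
    (h44 : ‖LL - (F + Z * Fb)‖ ≤ ε₄₄) : ‖F + Z * Fb‖ ≤ ε₄₄ := by
  rwa [hρ, zero_sub, norm_neg] at h44

/-- **Lemma 4.8, EXACT with its error** ("multiplying both sides by `Z̃(ρ,ψ)⁻¹G(ρ,ψ)` and applying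
Lemma 4.1"): if `|F + Z̃F̄| ≤ ε₁`, `|FG − 1| ≤ ε₂` and `Z̃ ≠ 0`, then
`|Z̃⁻¹ + G·F̄| ≤ |Z̃⁻¹|·(|G|·ε₁ + ε₂)` — i.e. `Z̃(ρ)⁻¹ = −G(ρ)F(1−ρ,ψ̄) + O(𝓛^{79}𝓛^{−179} + 𝓛^{−227})`
once `|Z̃(ρ)⁻¹| ≍ 1` ((4.5) on the critical line). [cite: Zhang2022LandauSiegel, §4 Lemma 4.8] -/
theorem lemma48 {F G Z Fb : ℂ} {ε₁ ε₂ : ℝ} (hZ : Z ≠ 0) (h44 : ‖F + Z * Fb‖ ≤ ε₁)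
    (h42 : ‖F * G - 1‖ ≤ ε₂) : ‖Z⁻¹ + G * Fb‖ ≤ ‖Z⁻¹‖ * (‖G‖ * ε₁ + ε₂) := by
  have hkey : Z⁻¹ + G * Fb = Z⁻¹ * (G * (F + Z * Fb) - (F * G - 1)) := by
    field_simp
    ring
  rw [hkey, norm_mul]
  refine mul_le_mul_of_nonneg_left ?_ (norm_nonneg _)
  calc ‖G * (F + Z * Fb) - (F * G - 1)‖ ≤ ‖G * (F + Z * Fb)‖ + ‖F * G - 1‖ := norm_sub_le _ _
    _ = ‖G‖ * ‖F + Z * Fb‖ + ‖F * G - 1‖ := by rw [norm_mul]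
    _ ≤ ‖G‖ * ε₁ + ε₂ := by gcongr

/-- The exponent bookkeeping of (4.10) / Lemma 4.8 (the cell's design rows I-4.10a, I-L4.8a):
`179 − 79 = 100` and `min(179 − 79, 227) = 100`. [cite: Zhang2022LandauSiegel, §4 (4.10), Lemma 4.8] -/
theorem exponent_410 : min ((179 : ℝ) - 79) 227 = 100 := by norm_num

/-! ### Lemma 4.5, Case 1: "Hence, by (4.5), `ℬ(s,ψ) ≪ P^{1/2−σ}`" — the bookkeeping -/

/-- With `P = exp{𝓛⁹}` (2.6) and `σ − 1/2 ≥ 𝓛⁻¹` (Case 1): `P^{1/2−σ} ≤ e^{−𝓛⁸}`.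
[cite: Zhang2022LandauSiegel, §4 Lemma 4.5 (proof)] -/
theorem rpow_half_sub_le_exp_neg {P L σ : ℝ} (hP : 0 < P) (hlogP : Real.log P = L ^ 9) (hL : 0 < L)
    (hσ : 1 / L ≤ σ - 1 / 2) : P ^ (1 / 2 - σ) ≤ Real.exp (-L ^ 8) := by
  rw [Real.rpow_def_of_pos hP, hlogP]
  apply Real.exp_le_exp.mpr
  have h1 : L ^ 8 ≤ L ^ 9 * (σ - 1 / 2) := by
    have h2 : L ^ 9 * (1 / L) ≤ L ^ 9 * (σ - 1 / 2) := mul_le_mul_of_nonneg_left hσ (by positivity)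
    have h3 : L ^ 9 * (1 / L) = L ^ 8 := by field_simp
    linarith
  nlinarith

/-- **"By Lemma 4.2 and trivial estimation, `F(1−s,ψ̄)/F(s,ψ) ≪ D^c`. Hence, by (4.5),
`ℬ(s,ψ) ≪ P^{1/2−σ}`"** — the bookkeeping made exact: if `|ℬ| ≤ K·e^{c𝓛}·P^{2(1/2−σ)}` (from
`|Z̃(s)| ≤ K(Dp²t₀²)^{1/2−σ} ≤ K·P^{2(1/2−σ)}` for `σ > 1/2` and `|F(1−s,ψ̄)/F(s,ψ)| ≤ e^{c𝓛} = D^c`),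
`P = exp{𝓛⁹}`, `σ − 1/2 ≥ 𝓛⁻¹` and `c𝓛 ≤ 𝓛⁸`, then `|ℬ| ≤ K·P^{1/2−σ}` (one factor `P^{1/2−σ} ≤ e^{−𝓛⁸}`
absorbs `D^c`). [cite: Zhang2022LandauSiegel, §4 Lemma 4.5 (proof)] -/
theorem norm_calB_le_case1 {B : ℂ} {P L σ K c : ℝ} (hP : 0 < P) (hlogP : Real.log P = L ^ 9)
    (hL : 0 < L) (hσ : 1 / L ≤ σ - 1 / 2) (hK : 0 ≤ K) (hc : c * L ≤ L ^ 8)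
    (hB : ‖B‖ ≤ K * Real.exp (c * L) * P ^ (2 * (1 / 2 - σ))) : ‖B‖ ≤ K * P ^ (1 / 2 - σ) := by
  have hsplit : P ^ (2 * (1 / 2 - σ)) = P ^ (1 / 2 - σ) * P ^ (1 / 2 - σ) := by
    rw [← Real.rpow_add hP]; ring_nf
  have h1 := rpow_half_sub_le_exp_neg hP hlogP hL hσ
  have h2 : Real.exp (c * L) * P ^ (1 / 2 - σ) ≤ 1 := by
    calc Real.exp (c * L) * P ^ (1 / 2 - σ) ≤ Real.exp (c * L) * Real.exp (-L ^ 8) :=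
          mul_le_mul_of_nonneg_left h1 (Real.exp_pos _).le
      _ = Real.exp (c * L - L ^ 8) := by rw [← Real.exp_add]; ring_nf
      _ ≤ 1 := Real.exp_le_one_iff.mpr (by linarith)
  have hpow : 0 ≤ P ^ (1 / 2 - σ) := (Real.rpow_pos_of_pos hP _).le
  calc ‖B‖ ≤ K * Real.exp (c * L) * P ^ (2 * (1 / 2 - σ)) := hB
    _ = K * P ^ (1 / 2 - σ) * (Real.exp (c * L) * P ^ (1 / 2 - σ)) := by rw [hsplit]; ring
    _ ≤ K * P ^ (1 / 2 - σ) * 1 := mul_le_mul_of_nonneg_left h2 (mul_nonneg hK hpow)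
    _ = K * P ^ (1 / 2 - σ) := mul_one _

end Lemma48

end Literature.NumberTheory.LFunctions.Zhang2022
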